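import Mathlib
import Summits.MatrixMultiplication.MatrixMultiplication.Theses.SnSubsetDichotomy
import Summits.MatrixMultiplication.MatrixMultiplication.Theorems.SnSubsetDichotomyJuntaBranchExitBBoundary

/-!
# `stub_alignedOrAbsent` (line `Sketch`, crux `SnSubsetDichotomy.JuntaBranch`,
# stmt-MatrixMultiplication-8304) — boundary test: the stub is false without `Large`

BOUNDARY TEST for the registered stub `stub_alignedOrAbsent` of line `Sketch` (card
alignment-trichotomy) of crux stmt-MatrixMultiplication-8304.  The stub says: in a `Large(c)` TPP
triple `S, T, U ⊆ S_n` (`(n!)^{3/2} e^{-c√n} ≤ |S||T||U|`), every `ε`-super-neutral block `(I → L)`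
of `S` at a level `1 ≤ t ≤ √n` is "cashable at its own target": there are injective `J, P` with the
`e^{c+1}` joint gain `e^{c+1}|S||T||U|((n−t)!/n!)^{3/2} ≤ |S_{I→L}||T_{J→L}||U_{P→L}|`.

`alignedOrAbsent_false_without_large` shows that the stub with its `Large` hypothesis
`(n!)^{3/2}e^{-c√n} ≤ |S||T||U|` deleted is FALSE; so `Large` is the stub's only lever (TPP, the
level range and the bump alone force no partner isotropy at `S`'s target).  It is an immediate
corollary of `bandRelocation_exitB_false_without_large`
(`SnSubsetDichotomyJuntaBranchExitBBoundary.lean`), which negates a statement with MORE hypotheses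
(inclusion-saturation of `T` and `U`, a band-exit disjunction on `t`, and an
`∃ ε', 0 < ε' ≤ ε` prefix) and the same conclusion: the `Large`-free stub implies that stronger
statement (take `ε' = ε` and ignore the extra hypotheses), whose witness is the level-1 fixed-point
family `(Stab(a), {(a x) : x < m}, {(a y) : y = a ∨ y ≥ m})` in `S_{2m}`.
-/

open Literature.Combinatorics.Additive
open Summit.MatrixMultiplication.MatrixMultiplication.Theses.SnSubsetDichotomy
open scoped Classical

set_option linter.dupNamespace false

namespace Summit.MatrixMultiplication.MatrixMultiplication.Theorems.JuntaBranch

/-- **`stub_alignedOrAbsent` is false without `Large` (boundary test).**  Deleting the largeness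
hypothesis `(n!)^{3/2}e^{-c√n} ≤ |S||T||U|` from the registered stub `stub_alignedOrAbsent` of line
`Sketch` gives a false statement: it is NOT the case that for all `ε, c > 0` and all large `n`,
every TPP triple `S, T, U ⊆ S_n` and every `ε`-super-neutral block `(I → L)` of `S` at a level
`1 ≤ t ≤ √n` (`n^{(1/2+ε)t}|S| < |S_{I→L}| · n(n-1)⋯(n-t+1)`) admit injective `J, P : Fin t → Fin n`
with `e^{c+1}|S||T||U|((n−t)!/n!)^{3/2} ≤ |S_{I→L}||T_{J→L}||U_{P→L}|`.  Corollary of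
`bandRelocation_exitB_false_without_large` (specialise `ε' := ε`, drop the saturation and band-exit
hypotheses); the witness there is the level-1 fixed-point family in `S_{2m}` with `ε = 1/4`,
`c = 1`. [folklore] -/
theorem alignedOrAbsent_false_without_large : ¬ (∀ ε : ℝ, 0 < ε → ∀ c : ℝ, 0 < c → ∃ n₀ : ℕ, ∀ n ≥ n₀, ∀ S T U : Finset (Equiv.Perm (Fin n)), TripleProductProperty S T U → ∀ t : ℕ, 1 ≤ t → (t : ℝ) ≤ Real.sqrt (n : ℝ) → ∀ I L : Fin t → Fin n, Function.Injective I → Function.Injective L → (n : ℝ) ^ ((1 / 2 + ε) * t) * (S.card : ℝ) < ((S.filter (fun σ => ∀ k, σ (I k) = L k)).card : ℝ) * (n.descFactorial t : ℝ) → ∃ J P : Fin t → Fin n, Function.Injective J ∧ Function.Injective P ∧ Real.exp (c + 1) * ((S.card * T.card * U.card : ℕ) : ℝ) * ((((n - t).factorial : ℕ) : ℝ) / (n.factorial : ℝ)) ^ ((3 : ℝ) / 2) ≤ (((S.filter (fun σ => ∀ k, σ (I k) = L k)).card * (T.filter (fun σ => ∀ k, σ (J k) = L k)).card * (U.filter (fun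 σ => ∀ k, σ (P k) = L k)).card : ℕ) : ℝ)) := by
  intro h
  refine bandRelocation_exitB_false_without_large ?_
  intro ε hε c hc
  obtain ⟨n₀, hn₀⟩ := h ε hε c hc
  refine ⟨ε, hε, le_rfl, n₀, ?_⟩
  intro n hn S T U hTPP _hsatT _hsatU t ht1 ht2 _hband I L hI hL hbump
  exact hn₀ n hn S T U hTPP t ht1 ht2 I L hI hL hbump

end Summit.MatrixMultiplication.MatrixMultiplication.Theorems.JuntaBranch
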